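import Summits.CriticalPhenomena.PercolationContinuityZ3.Theorems.PercNearOneGluingNoHeavyLowerTailKNGoodPocketBHKTwoSets
import HarnessLib

/-!
# `NoHeavyLowerTail` (stmt-CriticalPhenomena-4575) — the pocket-augmented BHK inequality for vertex SETS and a GENERAL
# increasing event of the edge cluster `C_S`

Support file (`--supports stmt-CriticalPhenomena-4575`, hull-port prover `prim-hp-2`, gen 23).  No definitions, no named
facts, no sorries; standard axioms.

`KNGoodPocketBHK.real_pocketAugSet_openConn_ge` (gen 21, file `…KNGoodPocketBHKTwoSets.lean`) is the set-source form of the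
pocket-augmented BHK inequality for the particular increasing event `{a ↔ b}`, `a ∈ S`.  The law-level certificates for
goodness with three relays (prim-hp-2 MEMO-gen23 §4: tilt frames with ALL up-set test functions) need it for an ARBITRARY
event `A` that is increasing and determined by `C_S = ⋃_{s ∈ S} C_s` (the union of the open edge clusters of the vertices of
`S`), e.g. `{b ↔ c or b ↔ t}` for `S = {c, b, t}` (the conditional tilt, MEMO-gen23 §3e Lemma 1).  This file proves it:

* `KNGoodPocketBHK.real_pocketAugSet_inter_ge` — for vertex sets `S, T`, a vertex `o`, ANY family `𝒬` of vertex sets disjoint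
  from `T`, and ANY event `A` with `ω ∈ A`, `C_S(ω) ⊆ C_S(ω')` ⟹ `ω' ∈ A`:
  `μ(A ∩ D) · μ(F ∩ D) ≤ μ(D) · μ(A ∩ F ∩ D)`,  `D = {S ↮ T}`,  `F = {o ↔ S} ∪ {C(o) ∈ 𝒬}`.
  Proof: BHK's hub transport (Remark 1), word for word as in the `{a ↔ b}` case, with the lifted event
  `A' = {all hub pairs of S open} ∩ {old pairs ∈ A}` (increasing and determined by the edge cluster of the hub).
[cite: VandenbergHaggstromKahn2005, Thm. 1.1 (pp. 3–5), Remark 1 after Thm. 1.2 (p. 5)] [cite: KozmaNitzan2024, §3.2 (p. 12)]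
-/

noncomputable section

namespace Summit.CriticalPhenomena.PercolationContinuityZ3.Theorems

open MeasureTheory Set Literature.Probability.LatticeModels Literature.Probability.Percolation
open scoped Classical

namespace KNGoodPocketBHK

variable {V : Type*}

section SetSource

open TwoSetConditionalAssociation

variable [Fintype V]

/-- **(II) for vertex SETS and a general increasing `C_S`-event.**  For bond percolation on a finite graph, vertex sets
`S, T`, a vertex `o`, ANY family `𝒬` of vertex sets disjoint from `T`, and any event `A` which is increasing and
determined by `C_S = ⋃_{s∈S} C_s` (`ω ∈ A ∧ C_S(ω) ⊆ C_S(ω') → ω' ∈ A`), with `D = {S ↮ T}` and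
`F = {o ↔ S} ∪ {C(o) ∈ 𝒬}`:   `μ(A ∩ D) · μ(F ∩ D) ≤ μ(D) · μ(A ∩ F ∩ D)`.
[cite: VandenbergHaggstromKahn2005, Thm. 1.1 (pp. 3–5), Remark 1 after Thm. 1.2 (p. 5)] [cite: KozmaNitzan2024, §3.2 (p. 12)] -/
theorem real_pocketAugSet_inter_ge (w : Sym2 V → unitInterval) (S T : Set V) (o : V)
    (Q : Set (Set V)) (hQ : ∀ W ∈ Q, Disjoint W T) (A : Set (BondConfig V))
    (hA : ∀ ω ω', ω ∈ A → (⋃ s ∈ S, openEdgeCluster ω s) ⊆ (⋃ s ∈ S, openEdgeCluster ω' s) → ω' ∈ A) :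
    (prodBernoulli w).real (A ∩ avoidSet S T) * (prodBernoulli w).real (pocketAugSet S o Q ∩ avoidSet S T) ≤
      (prodBernoulli w).real (avoidSet S T) *
        (prodBernoulli w).real (A ∩ (pocketAugSet S o Q ∩ avoidSet S T)) := by
  classical
  set side := sides S T with hside
  -- the data on the hub graph
  set Q' : Set (Set (V ⊕ Bool)) := (Set.image Sum.inl) '' Q with hQ'
  set A' : Set (BondConfig (V ⊕ Bool)) :=
    {ω' | (∀ s ∈ S, s(Sum.inl s, Sum.inr true) ∈ ω') ∧ restrictConfig Sum.inl ω' ∈ A} with hA'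
  have hQ'T : ∀ W' ∈ Q', Disjoint W' ({Sum.inr false} : Set (V ⊕ Bool)) := by
    rintro W' ⟨W, -, rfl⟩
    rw [Set.disjoint_singleton_right]
    rintro ⟨v, -, hv⟩
    exact Sum.inl_ne_inr hv
  -- a hub pair of `S` that is open lies in the edge cluster of the hub
  have hubmem : ∀ (ω' : BondConfig (V ⊕ Bool)) (s : V), s(Sum.inl s, Sum.inr true) ∈ ω' →
      s(Sum.inl s, Sum.inr true) ∈ openEdgeCluster ω' (Sum.inr true) := by
    intro ω' s hs
    refine (mem_openEdgeCluster_iff _ _ _).2 ⟨hs, ?_, fun v hv => ?_⟩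
    · rw [Sym2.mk_isDiag_iff]; exact Sum.inl_ne_inr
    · rcases Sym2.mem_iff.1 hv with rfl | rfl
      · exact SimpleGraph.Adj.reachable ((openGraph_adj ω' _ _).2 ⟨by rw [Sym2.eq_swap]; exact hs, Sum.inr_ne_inl⟩)
      · exact SimpleGraph.Reachable.refl _
  -- transfer of open paths from a vertex of `S` along an inclusion of hub edge clusters
  have transfer : ∀ (ω' ω'' : BondConfig (V ⊕ Bool)) (s : V), s(Sum.inl s, Sum.inr true) ∈ ω' →
      openEdgeCluster ω' (Sum.inr true) ⊆ openEdgeCluster ω'' (Sum.inr true) →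
      ∀ v, Relation.ReflTransGen (openGraph (restrictConfig Sum.inl ω')).Adj s v →
        (openGraph (restrictConfig Sum.inl ω'')).Reachable s v ∧ (openGraph ω').Reachable (Sum.inr true) (Sum.inl v) := by
    intro ω' ω'' s hs hsub v hv
    have hshub : (openGraph ω').Reachable (Sum.inr true) (Sum.inl s) :=
      SimpleGraph.Adj.reachable ((openGraph_adj ω' _ _).2 ⟨by rw [Sym2.eq_swap]; exact hs, Sum.inr_ne_inl⟩)
    induction hv with
    | refl => exact ⟨SimpleGraph.Reachable.refl s, hshub⟩
    | @tail p q _ hpq ih =>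
      rw [openGraph_adj, mem_restrictConfig, Sym2.map_mk] at hpq
      have hq' : (openGraph ω').Reachable (Sum.inr true) (Sum.inl q) :=
        ih.2.trans (SimpleGraph.Adj.reachable ((openGraph_adj ω' _ _).2
          ⟨hpq.1, fun h => hpq.2 (Sum.inl_injective h)⟩))
      have hmem : s(Sum.inl p, Sum.inl q) ∈ openEdgeCluster ω' (Sum.inr true) := by
        refine (mem_openEdgeCluster_iff _ _ _).2 ⟨hpq.1, ?_, fun v hv => ?_⟩
        · rw [Sym2.mk_isDiag_iff]; exact fun h => hpq.2 (Sum.inl_injective h)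
        · rcases Sym2.mem_iff.1 hv with rfl | rfl
          · exact ih.2
          · exact hq'
      refine ⟨ih.1.trans (SimpleGraph.Adj.reachable ((openGraph_adj _ _ _).2 ⟨?_, hpq.2⟩)), hq'⟩
      rw [mem_restrictConfig, Sym2.map_mk]
      exact (hsub hmem).1
  have hA'det : ∀ ω' ω'', ω' ∈ A' → openEdgeCluster ω' (Sum.inr true) ⊆ openEdgeCluster ω'' (Sum.inr true) →
      ω'' ∈ A' := by
    rintro ω' ω'' ⟨hhub, hrest⟩ hsub
    refine ⟨fun s hs => (hsub (hubmem ω' s (hhub s hs))).1, hA _ _ hrest fun e he => ?_⟩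
    -- `e ∈ C_S(restrict ω')` ⟹ `e ∈ C_S(restrict ω'')`
    rw [mem_biUnion_openEdgeCluster_iff] at he ⊢
    obtain ⟨heω, hdiag, hall⟩ := he
    have hreach : ∀ v ∈ e, ∃ s ∈ S, (openGraph (restrictConfig Sum.inl ω'')).Reachable s v ∧
        (openGraph ω').Reachable (Sum.inr true) (Sum.inl v) := by
      intro v hv
      obtain ⟨s, hs, hsv⟩ := hall v hv
      rw [SimpleGraph.reachable_iff_reflTransGen] at hsv
      exact ⟨s, hs, transfer ω' ω'' s (hhub s hs) hsub v hsv⟩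
    refine ⟨?_, hdiag, fun v hv => ?_⟩
    · -- the pair itself lies in the hub's edge cluster of `ω'`, hence of `ω''`
      have hmem : Sym2.map Sum.inl e ∈ openEdgeCluster ω' (Sum.inr true) := by
        refine (mem_openEdgeCluster_iff _ _ _).2 ⟨(mem_restrictConfig _ _ _).1 heω, ?_, fun v' hv' => ?_⟩
        · rw [Sym2.isDiag_map Sum.inl_injective]; exact hdiag
        · obtain ⟨v, hv, rfl⟩ := Sym2.mem_map.1 hv'
          exact ((hreach v hv).choose_spec.2).2
      rw [mem_restrictConfig]
      exact (hsub hmem).1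
    · obtain ⟨s, hs, hsv, -⟩ := hreach v hv
      exact ⟨s, hs, hsv⟩
  have key := real_pocketAug_inter_ge (hubWeight w side) (Sum.inr true) (Sum.inl o) {Sum.inr false} Q' hQ'T A' hA'det
  simp only [measureReal_hub] at key
  -- identification of the four preimages
  have hD : hubConfig side ⁻¹' avoid (Sum.inr true) ({Sum.inr false} : Set (V ⊕ Bool)) = avoidSet S T := by
    have h1 : avoid (Sum.inr true) ({Sum.inr false} : Set (V ⊕ Bool)) =
        {ω' | ¬ (openGraph ω').Reachable (Sum.inr true) (Sum.inr false)} := by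
      ext ω'; simp only [avoid, Set.mem_singleton_iff, forall_eq, Set.mem_setOf_eq]
    rw [h1, hubConfig_preimage_not_reachable]
    ext ω; simp only [hside, sides_true, sides_false, avoidSet, Set.mem_setOf_eq]
  have hAp : hubConfig side ⁻¹' A' = A := by
    ext ω
    simp only [hA', Set.mem_preimage, Set.mem_setOf_eq, restrictConfig_hubConfig]
    constructor
    · exact fun h => h.2
    · intro h
      refine ⟨fun s hs => ?_, h⟩
      exact Or.inr ⟨true, s, by simpa [hside] using hs, rfl⟩
  have hF : ∀ ω ∈ avoidSet S T, hubConfig side ω ∈ pocketAug (Sum.inr true) (Sum.inl o) Q' ↔ ω ∈ pocketAugSet S o Q := by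
    intro ω hω
    have hsep : ∀ s ∈ side true, ∀ t ∈ side (!true), ¬ (openGraph ω).Reachable s t := by
      intro s hs t ht
      simp only [hside, sides_true, sides_false, Bool.not_true] at hs ht
      exact hω s hs t ht
    simp only [pocketAug, pocketAugSet, Set.mem_setOf_eq]
    constructor
    · rintro (h | h)
      · obtain ⟨s, hs, hso⟩ := exists_reachable_of_hub_reachable side ω true hsep h.symm
        exact Or.inl ⟨s, by simpa [hside] using hs, hso.symm⟩
      · obtain ⟨W, hW, hWeq⟩ := h
        by_cases hoS : ∃ s ∈ S, (openGraph ω).Reachable o s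
        · exact Or.inl hoS
        have hoT : ∀ t ∈ T, ¬ (openGraph ω).Reachable o t := by
          intro t ht hot
          have : Sum.inr false ∈ openCluster (hubConfig side ω) (Sum.inl o) :=
            (hubConfig_reachable_inl side hot).trans
              (hubConfig_adj_hub side ω (b := false) (by simpa [hside] using ht)).reachable.symm
          rw [← hWeq] at this
          obtain ⟨v, -, hv⟩ := this
          exact Sum.inl_ne_inr hv
        have ho : ∀ b' : Bool, ∀ u ∈ side b', ¬ (openGraph ω).Reachable o u := by
          rintro (_ | _) u hu
          · exact hoT u (by simpa [hside] using hu)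
          · exact fun h => hoS ⟨u, by simpa [hside] using hu, h⟩
        rw [openCluster_hub_inl side ω o ho] at hWeq
        rw [Set.image_injective.2 Sum.inl_injective hWeq] at hW
        exact Or.inr hW
    · rintro (⟨s, hs, hos⟩ | h)
      · exact Or.inl ((hubConfig_reachable_hub_inl side ω (b := true) (by simpa [hside] using hs) hos.symm).symm)
      · by_cases hoS : ∃ s ∈ S, (openGraph ω).Reachable o s
        · obtain ⟨s, hs, hos⟩ := hoS
          exact Or.inl ((hubConfig_reachable_hub_inl side ω (b := true) (by simpa [hside] using hs) hos.symm).symm)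
        have hoT : ∀ t ∈ T, ¬ (openGraph ω).Reachable o t := fun t ht hot =>
          Set.disjoint_left.1 (hQ _ h) (show t ∈ openCluster ω o from hot) ht
        have ho : ∀ b' : Bool, ∀ u ∈ side b', ¬ (openGraph ω).Reachable o u := by
          rintro (_ | _) u hu
          · exact hoT u (by simpa [hside] using hu)
          · exact fun h' => hoS ⟨u, by simpa [hside] using hu, h'⟩
        refine Or.inr ⟨openCluster ω o, h, ?_⟩
        rw [openCluster_hub_inl side ω o ho]
  have hFD : hubConfig side ⁻¹' (pocketAug (Sum.inr true) (Sum.inl o) Q' ∩ avoid (Sum.inr true) {Sum.inr false}) =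
      pocketAugSet S o Q ∩ avoidSet S T := by
    ext ω
    rw [Set.preimage_inter, hD, Set.mem_inter_iff, Set.mem_inter_iff, Set.mem_preimage]
    exact ⟨fun h => ⟨(hF ω h.2).1 h.1, h.2⟩, fun h => ⟨(hF ω h.2).2 h.1, h.2⟩⟩
  have e1 : hubConfig side ⁻¹' (A' ∩ avoid (Sum.inr true) {Sum.inr false}) = A ∩ avoidSet S T := by
    rw [Set.preimage_inter, hAp, hD]
  have e4 : hubConfig side ⁻¹' (A' ∩ (pocketAug (Sum.inr true) (Sum.inl o) Q' ∩ avoid (Sum.inr true) {Sum.inr false})) =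
      A ∩ (pocketAugSet S o Q ∩ avoidSet S T) := by
    rw [Set.preimage_inter, hAp, hFD]
  rw [e1, hFD, hD, e4] at key
  exact key

omit [Fintype V] in
/-- **The up-set test functions of the law-level certificates are admissible**: for vertices `x ∈ S` and `y`, the event
`{x ↔ y}` is increasing and determined by `C_S`; so is any finite union / intersection of such events (unions and
intersections of admissible events are admissible).  This lemma records the basic case.
[cite: VandenbergHaggstromKahn2005, §1 p. 3 (events determined by the open cluster)] -/
theorem openConn_determinedBy_biUnion (S : Set V) {x : V} (hx : x ∈ S) (y : V) :
    ∀ ω ω' : BondConfig V, ω ∈ openConn x y → (⋃ s ∈ S, openEdgeCluster ω s) ⊆ (⋃ s ∈ S, openEdgeCluster ω' s) →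
      ω' ∈ openConn x y := by
  intro ω ω' hω hsub
  simp only [openConn, Set.mem_setOf_eq] at hω ⊢
  -- transfer an open walk from `x` edge by edge
  rw [SimpleGraph.reachable_iff_reflTransGen] at hω
  induction hω with
  | refl => exact SimpleGraph.Reachable.refl x
  | @tail p q hxp hpq ih =>
    have hxp' : (openGraph ω).Reachable x p := (SimpleGraph.reachable_iff_reflTransGen _ _).2 hxp
    rw [openGraph_adj] at hpq
    have hmem : s(p, q) ∈ ⋃ s ∈ S, openEdgeCluster ω s := by
      rw [mem_biUnion_openEdgeCluster_iff]
      refine ⟨hpq.1, by rw [Sym2.mk_isDiag_iff]; exact hpq.2, fun v hv => ⟨x, hx, ?_⟩⟩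
      rcases Sym2.mem_iff.1 hv with rfl | rfl
      · exact hxp'
      · exact hxp'.trans (SimpleGraph.Adj.reachable ((openGraph_adj ω _ _).2 hpq))
    have hmem' := hsub hmem
    rw [mem_biUnion_openEdgeCluster_iff] at hmem'
    exact ih.trans (SimpleGraph.Adj.reachable ((openGraph_adj ω' _ _).2 ⟨hmem'.1, hpq.2⟩))

omit [Fintype V] in
/-- Unions of admissible (increasing, `C_S`-determined) events are admissible. [folklore] -/
theorem union_determinedBy_biUnion (S : Set V) {A B : Set (BondConfig V)}
    (hA : ∀ ω ω' : BondConfig V, ω ∈ A → (⋃ s ∈ S, openEdgeCluster ω s) ⊆ (⋃ s ∈ S, openEdgeCluster ω' s) → ω' ∈ A)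
    (hB : ∀ ω ω' : BondConfig V, ω ∈ B → (⋃ s ∈ S, openEdgeCluster ω s) ⊆ (⋃ s ∈ S, openEdgeCluster ω' s) → ω' ∈ B) :
    ∀ ω ω' : BondConfig V, ω ∈ A ∪ B → (⋃ s ∈ S, openEdgeCluster ω s) ⊆ (⋃ s ∈ S, openEdgeCluster ω' s) →
      ω' ∈ A ∪ B := by
  rintro ω ω' (h | h) hsub
  · exact Or.inl (hA ω ω' h hsub)
  · exact Or.inr (hB ω ω' h hsub)

omit [Fintype V] in
/-- Intersections of admissible (increasing, `C_S`-determined) events are admissible. [folklore] -/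
theorem inter_determinedBy_biUnion (S : Set V) {A B : Set (BondConfig V)}
    (hA : ∀ ω ω' : BondConfig V, ω ∈ A → (⋃ s ∈ S, openEdgeCluster ω s) ⊆ (⋃ s ∈ S, openEdgeCluster ω' s) → ω' ∈ A)
    (hB : ∀ ω ω' : BondConfig V, ω ∈ B → (⋃ s ∈ S, openEdgeCluster ω s) ⊆ (⋃ s ∈ S, openEdgeCluster ω' s) → ω' ∈ B) :
    ∀ ω ω' : BondConfig V, ω ∈ A ∩ B → (⋃ s ∈ S, openEdgeCluster ω s) ⊆ (⋃ s ∈ S, openEdgeCluster ω' s) →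
      ω' ∈ A ∩ B :=
  fun ω ω' h hsub => ⟨hA ω ω' h.1 hsub, hB ω ω' h.2 hsub⟩

end SetSource

end KNGoodPocketBHK

end Summit.CriticalPhenomena.PercolationContinuityZ3.Theorems
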